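import Mathlib
import Literature.MathematicalPhysics.StatisticalMechanics.BarlowStacking
import Summits.Ventures.Crystal3D.Theorems.StickyWulffConstantStackingLiminfLayerChainV4Defs
import Summits.Ventures.Crystal3D.Theorems.StickyWulffConstantStackingLiminfMollifierSmooth
import Summits.Ventures.Crystal3D.Theorems.StickyWulffConstantStackingLiminfRungBumpMass
import Summits.Ventures.Crystal3D.Theorems.StickyWulffConstantStackingLiminfRungSmoothMass
import Summits.Ventures.Crystal3D.Theorems.StickyWulffConstantStackingLiminfKernelBounds
import Summits.Ventures.Crystal3D.Theorems.StickyWulffConstantStackingLiminfTwelveSlots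
import Summits.Ventures.Crystal3D.Theorems.StickyWulffConstantStackingLiminfVacantPairs
import Summits.Ventures.Crystal3D.Theorems.StickyWulffConstantStackingLiminfLayerSplit
import HarnessLib

/-!
# S4(iii) of stub (B) `MollifiedUpper` (line LayerChain v4, crux `StackingLiminf`, stmt-Ventures-19145):
# the OCCUPIED × VACANT overlap mass `∫ v·u ≤ C · K · D`

Cell `crystal3d-full`, venture `Summits/Ventures/Crystal3D`.  BLUEPRINT-v4B S4(iii): for an injective
configuration `x` in the Barlow stacking of a Hägg word, `K ≥ 1`, and any finite set `F` of VACANT lattice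
indices, the overlap of the mollified occupied density `v = dens x K` with the mollified vacancy density
`u_F = Σ_{t∈F} φ_K(· − barlowPos t)` satisfies

`∫ v · u_F ≤ (bumpConst/(√2 K³)) · (2R+1)³ · 3R · (12N − 2·numContacts x)`, `R = 11⌈K⌉`
(`integral_dens_mul_vacant_le`), hence `≤ C_V · K · (6N − numContacts x)` (`integral_dens_mul_vacant_le'`,
`C_V = 12028500 · bumpConst/√2`): each pair contributes `∫ φ_K(y − x_i) φ_K(y − p_t) dy ≤ ‖φ_K‖_∞ ∫φ_K =
bumpConst/(√2K³)`, and only pairs at sup-distance `< 2K` contribute (supports), which are counted by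
`card_nearVacantPairs_le` (…VacantPairs).  This is the `∫ v u ≤ C K D` input of the skew bound
`‖E‖₁ ≤ 4∫ v u + (C/K)·vol{v > ¼}` (S4(ii)).
WHAT THIS IS NOT: the skew bound S4 (needs also the lateral quadrature S4(i)); rung F-C1 not moved.
-/

noncomputable section

namespace Summit.Ventures.Crystal3D.Theorems

open MeasureTheory Set Function Metric
open Literature.MathematicalPhysics.StatisticalMechanics
open Summit.Ventures.Crystal3D.LayerChain (dot3)
open Summit.Ventures.Crystal3D.Cruxes.StackingLiminf.LayerChainV4 (bump bumpConst dens)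

variable {N : ℕ}

/-- A nonzero value of the bump forces sup-norm distance `< K`. -/
theorem norm_lt_of_bump_ne_zero {K : ℝ} (hK : 0 < K) {u : Fin 3 → ℝ} (hu : bump K u ≠ 0) : ‖u‖ < K := by
  rw [pi_norm_lt_iff hK]
  intro j
  by_contra h
  rw [not_lt, Real.norm_eq_abs] at h
  exact hu (bump_eq_zero_of_coord hK j h)

/-- The overlap integral of two bumps is at most `bumpConst/(√2 K³)`. -/
theorem integral_bump_mul_bump_le {K : ℝ} (hK : 0 < K) (p q : Fin 3 → ℝ) :
    ∫ y : Fin 3 → ℝ, bump K (y - p) * bump K (y - q) ≤ bumpConst / (Real.sqrt 2 * K ^ 3) := by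
  have hIq : Integrable fun y : Fin 3 → ℝ => bump K (y - q) :=
    ((continuous_bump K).integrable_of_hasCompactSupport (hasCompactSupport_bump hK)).comp_sub_right q
  have hIpq : Integrable fun y : Fin 3 → ℝ => bump K (y - p) * bump K (y - q) := by
    refine (((continuous_bump K).comp (continuous_id.sub continuous_const)).mul
      ((continuous_bump K).comp (continuous_id.sub continuous_const))).integrable_of_hasCompactSupport ?_
    exact ((hasCompactSupport_bump hK).comp_homeomorph (Homeomorph.subRight q)).mul_left
  calc ∫ y : Fin 3 → ℝ, bump K (y - p) * bump K (y - q)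
      ≤ ∫ y : Fin 3 → ℝ, bumpConst / K ^ 3 * bump K (y - q) := by
        refine integral_mono hIpq (hIq.const_mul _) fun y => ?_
        exact mul_le_mul_of_nonneg_right (PlateauHeight.bump_le hK _) (bump_nonneg hK _)
    _ = bumpConst / K ^ 3 * (1 / Real.sqrt 2) := by
        rw [integral_const_mul, integral_sub_right_eq_self (bump K) q, rung_integral_bump K hK]
    _ = bumpConst / (Real.sqrt 2 * K ^ 3) := by
        field_simp

/-- Two bumps at sup-distance `≥ 2K` have identically vanishing product. -/
theorem bump_mul_bump_eq_zero {K : ℝ} (hK : 0 < K) {p q : Fin 3 → ℝ} (h : ¬ ‖p - q‖ < 2 * K)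
    (y : Fin 3 → ℝ) : bump K (y - p) * bump K (y - q) = 0 := by
  by_contra hne
  rcases mul_ne_zero_iff.1 hne with ⟨h1, h2⟩
  have n1 := norm_lt_of_bump_ne_zero hK h1
  have n2 := norm_lt_of_bump_ne_zero hK h2
  apply h
  calc ‖p - q‖ = ‖(y - q) - (y - p)‖ := by congr 1; abel
    _ ≤ ‖y - q‖ + ‖y - p‖ := norm_sub_le _ _
    _ < K + K := add_lt_add n2 n1
    _ = 2 * K := by ring

/-- **Occupied × vacant overlap mass (BLUEPRINT S4(iii)).** -/
theorem integral_dens_mul_vacant_le {σ : ℤ → ℤ} (hσ : IsHaggSeq σ) (x : Fin N → EuclideanSpace ℝ (Fin 3))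
    (hx : Function.Injective x) (hmem : ∀ i, x i ∈ barlowStacking 1 (Real.sqrt (2 / 3)) σ)
    {K : ℝ} (hK : 1 ≤ K) (F : Finset (ℤ × ℤ × ℤ))
    (hF : ∀ t ∈ F, barlowPos 1 (Real.sqrt (2 / 3)) σ t.1 t.2.1 t.2.2 ∉ Set.range x) :
    ∫ y : Fin 3 → ℝ, dens x K y *
        ∑ t ∈ F, bump K (y - WithLp.ofLp (barlowPos 1 (Real.sqrt (2 / 3)) σ t.1 t.2.1 t.2.2)) ≤
      bumpConst / (Real.sqrt 2 * K ^ 3) *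
        (((2 * (11 * ⌈K⌉₊) + 1) ^ 3 * (3 * (11 * ⌈K⌉₊)) *
          (12 * N - 2 * Summit.Ventures.Crystal3D.numContacts x) : ℕ) : ℝ) := by
  classical
  have hK0 : 0 < K := by linarith
  choose kk ii jj hidx using hmem
  set a : Fin N → ℤ × ℤ × ℤ := fun i => (kk i, ii i, jj i) with ha_def
  have ha : ∀ i, x i = barlowPos 1 (Real.sqrt (2 / 3)) σ (a i).1 (a i).2.1 (a i).2.2 := fun i => hidx i
  set P : ℤ × ℤ × ℤ → (Fin 3 → ℝ) := fun t =>
    WithLp.ofLp (barlowPos 1 (Real.sqrt (2 / 3)) σ t.1 t.2.1 t.2.2) with hP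
  set c : ℝ := bumpConst / (Real.sqrt 2 * K ^ 3) with hc
  have hc0 : 0 ≤ c := by rw [hc]; exact div_nonneg bumpConst_pos.le (by positivity)
  change ∫ y : Fin 3 → ℝ, dens x K y * ∑ t ∈ F, bump K (y - P t) ≤
    c * (((2 * (11 * ⌈K⌉₊) + 1) ^ 3 * (3 * (11 * ⌈K⌉₊)) *
      (12 * N - 2 * Summit.Ventures.Crystal3D.numContacts x) : ℕ) : ℝ)
  -- expand the product of sums
  have hexp : ∀ y : Fin 3 → ℝ, dens x K y * ∑ t ∈ F, bump K (y - P t) =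
      ∑ i, ∑ t ∈ F, bump K (y - WithLp.ofLp (x i)) * bump K (y - P t) := by
    intro y
    unfold dens
    rw [Finset.sum_mul_sum]
    rfl
  have hIit : ∀ (i : Fin N) (t : ℤ × ℤ × ℤ), Integrable fun y : Fin 3 → ℝ =>
      bump K (y - WithLp.ofLp (x i)) * bump K (y - P t) := by
    intro i t
    refine (((continuous_bump K).comp (continuous_id.sub continuous_const)).mul
      ((continuous_bump K).comp (continuous_id.sub continuous_const))).integrable_of_hasCompactSupport ?_
    exact ((hasCompactSupport_bump hK0).comp_homeomorph (Homeomorph.subRight (P t))).mul_left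
  simp_rw [hexp]
  rw [integral_finsetSum _ fun i _ => integrable_finsetSum _ fun t _ => hIit i t]
  simp_rw [integral_finsetSum _ fun t _ => hIit _ t]
  -- bound each pair
  have hpair : ∀ (i : Fin N) (t : ℤ × ℤ × ℤ), ∫ y : Fin 3 → ℝ, bump K (y - WithLp.ofLp (x i)) * bump K (y - P t) ≤
      if ‖WithLp.ofLp (x i) - P t‖ < 2 * K then c else 0 := by
    intro i t
    split_ifs with hnear
    · exact integral_bump_mul_bump_le hK0 _ _
    · simp_rw [bump_mul_bump_eq_zero hK0 hnear]
      simp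
  calc ∑ i, ∑ t ∈ F, ∫ y : Fin 3 → ℝ, bump K (y - WithLp.ofLp (x i)) * bump K (y - P t)
      ≤ ∑ i, ∑ t ∈ F, (if ‖WithLp.ofLp (x i) - P t‖ < 2 * K then c else 0) :=
        Finset.sum_le_sum fun i _ => Finset.sum_le_sum fun t _ => hpair i t
    _ = c * (((Finset.univ ×ˢ F).filter fun q : Fin N × (ℤ × ℤ × ℤ) =>
          ‖WithLp.ofLp (x q.1) - P q.2‖ < 2 * K).card : ℝ) := by
        rw [← Finset.sum_product (f := fun q : Fin N × (ℤ × ℤ × ℤ) =>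
          if ‖WithLp.ofLp (x q.1) - P q.2‖ < 2 * K then c else 0), ← Finset.sum_filter,
          Finset.sum_const, nsmul_eq_mul, mul_comm]
    _ ≤ c * (((2 * (11 * ⌈K⌉₊) + 1) ^ 3 * (3 * (11 * ⌈K⌉₊)) *
          (12 * N - 2 * Summit.Ventures.Crystal3D.numContacts x) : ℕ) : ℝ) := by
        refine mul_le_mul_of_nonneg_left ?_ hc0
        exact_mod_cast card_nearVacantPairs_le hσ x hx a ha K F hF

/-- **Occupied × vacant overlap mass, `C · K · D` form**: `∫ v · u_F ≤ C_V · K · (6N − numContacts x)` with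
`C_V = 12028500 · bumpConst / √2`. -/
theorem integral_dens_mul_vacant_le' {σ : ℤ → ℤ} (hσ : IsHaggSeq σ) (x : Fin N → EuclideanSpace ℝ (Fin 3))
    (hx : Function.Injective x) (hmem : ∀ i, x i ∈ barlowStacking 1 (Real.sqrt (2 / 3)) σ)
    {K : ℝ} (hK : 1 ≤ K) (F : Finset (ℤ × ℤ × ℤ))
    (hF : ∀ t ∈ F, barlowPos 1 (Real.sqrt (2 / 3)) σ t.1 t.2.1 t.2.2 ∉ Set.range x) :
    ∫ y : Fin 3 → ℝ, dens x K y *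
        ∑ t ∈ F, bump K (y - WithLp.ofLp (barlowPos 1 (Real.sqrt (2 / 3)) σ t.1 t.2.1 t.2.2)) ≤
      12028500 * bumpConst / Real.sqrt 2 * K *
        (6 * (N : ℝ) - (Summit.Ventures.Crystal3D.numContacts x : ℝ)) := by
  have hK0 : 0 < K := by linarith
  have h := integral_dens_mul_vacant_le hσ x hx hmem hK F hF
  refine le_trans h ?_
  -- `2·numContacts ≤ 12 N`
  obtain ⟨kk, hkf⟩ := exists_layerMap x hmem
  have hslots := sum_vacant_add_two_mul_numContacts hσ x hx hmem kk hkf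
  have h2C : 2 * Summit.Ventures.Crystal3D.numContacts x ≤ 12 * N := le_trans (Nat.le_add_left _ _) hslots.le
  have hcast : (((12 * N - 2 * Summit.Ventures.Crystal3D.numContacts x : ℕ)) : ℝ) =
      2 * (6 * (N : ℝ) - (Summit.Ventures.Crystal3D.numContacts x : ℝ)) := by
    rw [Nat.cast_sub h2C]; push_cast; ring
  have hD0 : 0 ≤ 6 * (N : ℝ) - (Summit.Ventures.Crystal3D.numContacts x : ℝ) := by
    have : ((2 * Summit.Ventures.Crystal3D.numContacts x : ℕ) : ℝ) ≤ ((12 * N : ℕ) : ℝ) := by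
      exact_mod_cast h2C
    push_cast at this; linarith
  -- `⌈K⌉ ≤ 2K`
  have hceil : (⌈K⌉₊ : ℝ) ≤ 2 * K := by
    have := Nat.ceil_lt_add_one hK0.le; linarith
  have hR1 : ((2 * (11 * ⌈K⌉₊) + 1 : ℕ) : ℝ) ≤ 45 * K := by push_cast; linarith
  have hR2 : ((3 * (11 * ⌈K⌉₊) : ℕ) : ℝ) ≤ 66 * K := by push_cast; linarith
  have hbc : 0 ≤ bumpConst := bumpConst_pos.le
  have hs2 : 0 < Real.sqrt 2 := Real.sqrt_pos.2 (by norm_num)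
  rw [Nat.cast_mul, Nat.cast_mul, Nat.cast_pow, hcast]
  have hpow : ((2 * (11 * ⌈K⌉₊) + 1 : ℕ) : ℝ) ^ 3 ≤ (45 * K) ^ 3 :=
    pow_le_pow_left₀ (Nat.cast_nonneg _) hR1 3
  calc bumpConst / (Real.sqrt 2 * K ^ 3) *
        (((2 * (11 * ⌈K⌉₊) + 1 : ℕ) : ℝ) ^ 3 * ((3 * (11 * ⌈K⌉₊) : ℕ) : ℝ) *
          (2 * (6 * (N : ℝ) - (Summit.Ventures.Crystal3D.numContacts x : ℝ))))
      ≤ bumpConst / (Real.sqrt 2 * K ^ 3) * ((45 * K) ^ 3 * (66 * K) *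
          (2 * (6 * (N : ℝ) - (Summit.Ventures.Crystal3D.numContacts x : ℝ)))) := by
        refine mul_le_mul_of_nonneg_left ?_ (by positivity)
        refine mul_le_mul_of_nonneg_right ?_ (by positivity)
        exact mul_le_mul hpow hR2 (Nat.cast_nonneg _) (by positivity)
    _ = 12028500 * bumpConst / Real.sqrt 2 * K *
          (6 * (N : ℝ) - (Summit.Ventures.Crystal3D.numContacts x : ℝ)) := by
        field_simp
        ring

end Summit.Ventures.Crystal3D.Theorems

end
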